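import Literature.NumberTheory.IwasawaTheory.SymmetricThreeCubicClosureResolvent
import Literature.NumberTheory.CubicFields.CubicFieldGaloisIffSquareDiscriminant
import HarnessLib

set_option autoImplicit false

/-!
# The square class of the discriminant of a non-Galois cubic field is the one rational square class that dies in its Galois closure

Topic `NumberTheory/CubicFields`; namespace `Literature.NumberTheory.CubicFields`.  THEOREM-ONLY file (no definition, no named fact, no `sorry`),
written by the prover seat `bsd-line-att-p4` g34 (cell `bsd-f1-sign2`, `--supports` stmt-BirchSwinnertonDyer-22298; closes nothing there; BSD is
proved for no curve here).  Sequel of `IwasawaTheory/SymmetricThreeCubicClosureResolvent` (same seat lineage, g33: the resolvent of a non-Galois cubic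
field `F` inside a Galois sextic `L ⊇ ι(F)` is `ℚ(√d_F)`, `d_F = NumberField.discr F`), which proved the special case `c = 2` («`2·d_F ∉ ℚ²` ⟹ `√2 ∉ L`»).
Here `c` is an arbitrary rational number:

* (private) `exists_add_mul_of_mem_adjoin_of_sq_eq` — elements of `ℚ(x)`, `x² = c ∈ ℚ`, are `a + b·x` (folklore).
* ★ `discr_eq_mul_sq_of_sq_eq` — **if `x ∈ L` with `x² = c`, `c ∈ ℚ` NOT a square, then `d_F = c·b²` for a rational `b ≠ 0`**: the quadratic field
  `ℚ(x) ≤ L` is the resolvent, so it contains `δ = a + b x ∉ ℚ` with `δ² = d_F`; comparing `ℚ`-parts, `a b = 0`, and `b = 0` would put `δ` in `ℚ`.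
* `exists_sq_eq_of_discr_eq_mul_sq` — conversely `d_F = c·b²`, `b ≠ 0` ⟹ `c = (δ/b)²` in `L`.
* ★★ `exists_sq_eq_iff_isSquare_or_isSquare_mul_discr` — **for `c ∈ ℚ`: `c` is a square in `L` ⟺ `c ∈ ℚ²` or `c·d_F ∈ ℚ²`**: the rational square
  classes becoming trivial in the Galois closure of an `S₃`-cubic are exactly `{1, d_F}·ℚˣ²`.

Consumer (Summits side, same seat): for an elliptic curve `W/ℚ` with `W(ℚ)[2] = 0`, `Δ_W ∉ ℚ²`, the `u`-cubic splits in the Galois closure of its cubic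
`2`-torsion field `F`, where `256·Δ_W` becomes a square; hence `d_F = Δ_W·b²` — the field discriminant of the cubic `2`-torsion field and the
discriminant of the curve have THE SAME SQUARE CLASS, so `v_p(d_F) ≡ v_p(Δ_min) (mod 2)` at every prime (good reduction at `2` ⟹ `v₂(d_F)` even).

## References
* D. A. Marcus, *Number Fields*, 2nd ed., Ch. 2 (discriminants and embeddings; the field `ℚ(√d)` inside the normal closure). [Marcus2018]
* H. Cohen, *A Course in Computational Algebraic Number Theory*, GTM 138, §6.3.3 (the resolvent `ℚ(√d_F)` of a non-cyclic cubic field). [Cohen1993]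
* H. Davenport, H. Heilbronn, Proc. Roy. Soc. London A 322 (1971), §6 (`K₂ = ℚ(√d)`). [DavenportHeilbronn1971]
-/

noncomputable section

open scoped NumberField
open NumberField Field IntermediateField Polynomial Module

namespace Literature.NumberTheory.CubicFields

open Literature.NumberTheory.IwasawaTheory Literature.NumberTheory.NumberFields

section GaloisClosure

variable {F : Type} [Field F] [NumberField F] (L : Type) [Field L] [NumberField L] [IsGalois ℚ L]

omit [IsGalois ℚ L] in
/-- Elements of `ℚ(x)` for `x² = c ∈ ℚ` are `a + b·x` (`a, b ∈ ℚ`): reduce a polynomial in `x` modulo `X² − c`. [folklore] -/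
private theorem exists_add_mul_of_mem_adjoin_of_sq_eq {x : L} {c : ℚ} (hx : x ^ 2 = algebraMap ℚ L c) {y : L}
    (hy : y ∈ ℚ⟮x⟯) : ∃ a b : ℚ, y = algebraMap ℚ L a + algebraMap ℚ L b * x := by
  have hmon : (X ^ 2 - C c : ℚ[X]).Monic := monic_X_pow_sub_C c two_ne_zero
  have hroot : aeval x (X ^ 2 - C c : ℚ[X]) = 0 := by simp [hx]
  have hint : IsIntegral ℚ x := ⟨_, hmon, by simpa [eval₂_eq_eval_map] using hroot⟩
  rw [← IntermediateField.mem_toSubalgebra, adjoin_simple_toSubalgebra_of_isAlgebraic hint.isAlgebraic,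
    Algebra.adjoin_singleton_eq_range_aeval] at hy
  obtain ⟨f, rfl⟩ := hy
  have hdeg : (f %ₘ (X ^ 2 - C c)).natDegree ≤ 1 := by
    have hne1 : (X ^ 2 - C c : ℚ[X]) ≠ 1 := fun h ↦ by
      have := congrArg natDegree h
      rw [natDegree_X_pow_sub_C, natDegree_one] at this
      omega
    have h := natDegree_modByMonic_lt f hmon hne1
    rw [natDegree_X_pow_sub_C] at h
    omega
  refine ⟨(f %ₘ (X ^ 2 - C c)).coeff 0, (f %ₘ (X ^ 2 - C c)).coeff 1, ?_⟩
  change aeval x f = _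
  rw [← aeval_modByMonic_eq_self_of_root (p := f) hroot]
  conv_lhs => rw [eq_X_add_C_of_natDegree_le_one hdeg]
  simp only [map_add, map_mul, aeval_C, aeval_X]
  ring

variable (hL : finrank ℚ L = 6) (hF : finrank ℚ F = 3) (hFG : ¬ IsGalois ℚ F) (ι : F →ₐ[ℚ] L)
include hL hF hFG ι

/-- ★ **The square class of `d_F` is detected in the Galois closure.** `L/ℚ` a Galois sextic receiving the non-Galois cubic field `F`; if `x ∈ L` satisfies
`x² = c` with `c ∈ ℚ` NOT a square, then `d_F = c·b²` for some rational `b ≠ 0`.  (`ℚ(x) ≤ L` is quadratic, hence the resolvent `ℚ(√d_F)`: it contains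
`δ = a + b·x ∉ ℚ` with `δ² = d_F`; the `x`-coefficient `2ab` of `δ²` vanishes, and `b = 0` is excluded.)
[cite: Marcus2018, Ch. 2 (discriminants and embeddings)] [cite: Cohen1993, §6.3.3] [cite: DavenportHeilbronn1971, §6] -/
theorem discr_eq_mul_sq_of_sq_eq {c : ℚ} (hc : ¬ IsSquare c) {x : L} (hx : x ^ 2 = algebraMap ℚ L c) :
    ∃ b : ℚ, b ≠ 0 ∧ (NumberField.discr F : ℚ) = c * b ^ 2 := by
  have hinj : Function.Injective (algebraMap ℚ L) := (algebraMap ℚ L).injective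
  -- `x ∉ ℚ`
  have hxQ : x ∉ Set.range (algebraMap ℚ L) := by
    rintro ⟨q, rfl⟩
    refine hc ⟨q, hinj ?_⟩
    rw [map_mul, ← sq, hx]
  -- `[ℚ(x) : ℚ] = 2`
  have hmon : (X ^ 2 - C c : ℚ[X]).Monic := monic_X_pow_sub_C _ two_ne_zero
  have hroot : aeval x (X ^ 2 - C c : ℚ[X]) = 0 := by simp [hx]
  have hint : IsIntegral ℚ x := ⟨_, hmon, by simpa [eval₂_eq_eval_map] using hroot⟩
  have hk2 : finrank ℚ ↥ℚ⟮x⟯ = 2 := by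
    rw [IntermediateField.adjoin.finrank hint]
    have hirr : Irreducible (X ^ 2 - C c : ℚ[X]) := by
      refine irreducible_of_degree_le_three_of_not_isRoot (by rw [natDegree_X_pow_sub_C]; decide) fun q hq ↦ ?_
      refine hc ⟨q, ?_⟩
      have : q ^ 2 - c = 0 := by simpa using hq
      nlinarith [this]
    rw [← minpoly.eq_of_irreducible_of_monic hirr hroot hmon, natDegree_X_pow_sub_C]
  -- `√d_F = a + b x ∈ ℚ(x)`
  obtain ⟨δ, hδk, hδsq, hδQ⟩ := exists_sqrt_discr_mem_quadratic L hL hF hFG ι ℚ⟮x⟯ hk2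
  obtain ⟨a, b, hab⟩ := exists_add_mul_of_mem_adjoin_of_sq_eq L hx hδk
  have h2 : δ ^ 2 = algebraMap ℚ L (NumberField.discr F : ℚ) := by rw [hδsq]; simp
  have key : algebraMap ℚ L (2 * a * b) * x = algebraMap ℚ L ((NumberField.discr F : ℚ) - a ^ 2 - c * b ^ 2) := by
    have h1 : δ ^ 2 = algebraMap ℚ L (a ^ 2 + c * b ^ 2) + algebraMap ℚ L (2 * a * b) * x := by
      rw [hab]; simp only [map_add, map_mul, map_pow, map_ofNat]; linear_combination (algebraMap ℚ L b) ^ 2 * hx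
    rw [map_sub, map_sub, ← h2, h1]; simp only [map_add, map_mul, map_pow, map_ofNat]; ring
  by_cases hab0 : 2 * a * b = 0
  · rcases mul_eq_zero.mp hab0 with ha | hb
    · have ha' : a = 0 := by simpa using ha
      -- `δ = b x`, `d_F = c b²`
      rw [ha', map_zero, zero_add] at hab
      have hb0 : b ≠ 0 := by
        intro hb0
        rw [hb0, map_zero, zero_mul] at hab
        exact hδQ ⟨0, by rw [map_zero, hab]⟩
      refine ⟨b, hb0, hinj ?_⟩
      rw [← h2, hab, mul_pow, hx, ← map_pow, ← map_mul]; ring_nf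
    · rw [hb, map_zero, zero_mul, add_zero] at hab
      exact absurd ⟨a, hab.symm⟩ hδQ
  · -- `x ∈ ℚ`: absurd
    exfalso
    apply hxQ
    refine ⟨((NumberField.discr F : ℚ) - a ^ 2 - c * b ^ 2) / (2 * a * b), ?_⟩
    rw [map_div₀, ← key, mul_comm, mul_div_assoc, div_self ((_root_.map_ne_zero _).mpr hab0), mul_one]

/-- **Conversely** `d_F = c·b²` with `b ≠ 0` ⟹ `c` is a square in `L` (namely `(δ/b)²` with `δ² = d_F`, `δ ∈ L`). [cite: Marcus2018, Ch. 2] -/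
theorem exists_sq_eq_of_discr_eq_mul_sq {c b : ℚ} (hb : b ≠ 0) (h : (NumberField.discr F : ℚ) = c * b ^ 2) :
    ∃ x : L, x ^ 2 = algebraMap ℚ L c := by
  obtain ⟨k, hk⟩ := exists_intermediateField_finrank_eq_two L hL
  obtain ⟨δ, -, hδsq, -⟩ := exists_sqrt_discr_mem_quadratic L hL hF hFG ι k hk
  have h2 : δ ^ 2 = algebraMap ℚ L (NumberField.discr F : ℚ) := by rw [hδsq]; simp
  refine ⟨δ * algebraMap ℚ L b⁻¹, ?_⟩
  rw [mul_pow, h2, ← map_pow, ← map_mul]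
  congr 1
  rw [h, inv_pow, mul_assoc, mul_inv_cancel₀ (pow_ne_zero 2 hb), mul_one]

/-- ★★ **The rational square classes that die in the Galois closure of an `S₃`-cubic are exactly `{1, d_F}`**: for `c ∈ ℚ`, `c` is a square in `L`
iff `c ∈ ℚ²` or `c·d_F ∈ ℚ²`. [cite: Marcus2018, Ch. 2 (discriminants and embeddings)] [cite: Cohen1993, §6.3.3] -/
theorem exists_sq_eq_iff_isSquare_or_isSquare_mul_discr (c : ℚ) :
    (∃ x : L, x ^ 2 = algebraMap ℚ L c) ↔ IsSquare c ∨ IsSquare (c * (NumberField.discr F : ℚ)) := by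
  constructor
  · rintro ⟨x, hx⟩
    by_cases hc : IsSquare c
    · exact Or.inl hc
    · obtain ⟨b, -, hb⟩ := discr_eq_mul_sq_of_sq_eq L hL hF hFG ι hc hx
      exact Or.inr ⟨c * b, by rw [hb]; ring⟩
  · rintro (⟨r, hr⟩ | ⟨r, hr⟩)
    · exact ⟨algebraMap ℚ L r, by rw [← map_pow, sq, ← hr]⟩
    · have hd : (NumberField.discr F : ℚ) ≠ 0 := Int.cast_ne_zero.mpr (NumberField.discr_ne_zero F)
      by_cases hc0 : c = 0
      · exact ⟨0, by rw [hc0, map_zero]; ring⟩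
      · -- `x = r/δ` with `δ² = d_F`: `x² = r²/d_F = c`
        obtain ⟨k, hk⟩ := exists_intermediateField_finrank_eq_two L hL
        obtain ⟨δ, -, hδsq, -⟩ := exists_sqrt_discr_mem_quadratic L hL hF hFG ι k hk
        have h2 : δ ^ 2 = algebraMap ℚ L (NumberField.discr F : ℚ) := by rw [hδsq]; simp
        refine ⟨algebraMap ℚ L r * δ⁻¹, ?_⟩
        rw [mul_pow, inv_pow, h2, ← map_pow, ← map_inv₀, ← map_mul]
        congr 1
        rw [sq, ← hr, mul_assoc, mul_inv_cancel₀ hd, mul_one]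

end GaloisClosure

end Literature.NumberTheory.CubicFields

end
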